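import Summits.ResolutionOfSingularities.ResolutionOfSingularities.Theorems.FrobeniusLadderFInjectiveMacaulayficationTauFloorOneChartYTransport
import Summits.ResolutionOfSingularities.ResolutionOfSingularities.Theorems.FrobeniusLadderFInjectiveMacaulayficationReesChartCongr
import HarnessLib

/-!
# F4POS-1 (d-C″): the charts `D(ū)`, `D(t̄)` of `Bl_τ(P2d4C)` by the symmetry `y ↔ u ↔ t` — CM at every prime, non-FULL along the exceptional divisor
# (crux `FInjectiveMacaulayfication` stmt-ResolutionOfSingularities-15315, chain w45a; res-L1-w45a-plan-1 R18.17 (b)/R18.18 «F4POS-1 (d)»; seat res-L1-w45a-stub-1 g10)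

[OURS · L1 W4.5a] Support file (`--supports stmt-ResolutionOfSingularities-15315 --as helper`); def-free, unconditional; replaces the role of NO printed item;
NOT a statement of the manuscript; AI-written (AI review is weaker than expert review).

`f = X₄² + X₀⁴X₄ + X₁³ + X₂³ + X₃³` is invariant under the transpositions `X₁ ↔ X₂`, `X₁ ↔ X₃`; the induced automorphisms `σ̄` of `A₀ = k[X]/(f)` fix
`τ = (x̄², ȳ, ū, t̄, z̄)` and send `ȳ` to `ū` resp. `t̄`, hence induce `A₀[τ/ȳ] ≃+* A₀[τ/ū]`, `A₀[τ/ȳ] ≃+* A₀[τ/t̄]` over `σ̄`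
(`ReesChartCongr.exists_blowupAlgebra_congr`, with the target rewritten through variables — `exists_blowupAlgebra_congr'`). Transporting
`TauFloorOneChartYTransport` (p622179): ★ `cmCl_localization_blowupAlgebra_u/_t` (every prime) and ★★ `not_fullCl_localization_blowupAlgebra_u/_t` (every prime
containing `ū/1` resp. `t̄/1`). With p622179 (`D(ȳ)`) and res-L1-w45a-stub-2's `D(x̄²)` twin, these are the chart inputs of the S′-assembly of F4POS-1 (d). [folklore]
-/

-- single-problem summit: the doubled namespace component is forced
set_option linter.dupNamespace false

noncomputable section

namespace Summit.ResolutionOfSingularities.ResolutionOfSingularities.Theorems.FInjectiveMacaulayfication.TauFloorOneChartSymmetry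

open MvPolynomial IsLocalRing Literature.AlgebraicGeometry.Resolution
open Summit.ResolutionOfSingularities.ResolutionOfSingularities.Theorems.FInjectiveMacaulayfication
open SliceableCentre

/-! ## §1 Generic: blow-up algebras along an isomorphism of the base, target through variables -/

/-- `ReesChartCongr.exists_blowupAlgebra_congr` with the target ideal and element given as variables (`I' = e(I)`, `b = e(a)`). [folklore] -/
theorem exists_blowupAlgebra_congr' {R : Type} [CommRing R] (e : R ≃+* R) (I I' : Ideal R) (hI : Ideal.map e I = I') (a b : R) (hb : e a = b) :
    ∃ E₀ : blowupAlgebra I a ≃+* blowupAlgebra I' b, ∀ r : R, E₀ (algebraMap R (blowupAlgebra I a) r) = algebraMap R (blowupAlgebra I' b) (e r) := by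
  subst hI; subst hb
  exact ReesChartCongr.exists_blowupAlgebra_congr e I a

/-- Transport of «CM at every prime» and «a marked element is bad» along such an `E₀`. [folklore] -/
theorem transport {R : Type} [CommRing R] {B B' : Type} [CommRing B] [CommRing B'] [Algebra R B] [Algebra R B'] (e : R ≃+* R) (E₀ : B ≃+* B')
    (hE₀ : ∀ r : R, E₀ (algebraMap R B r) = algebraMap R B' (e r)) (p : ℕ) (a : R)
    (hCM : ∀ (Q : Ideal B) [Q.IsPrime], CMCl (Localization.AtPrime Q))
    (hbad : ∀ (Q : Ideal B) [Q.IsPrime], algebraMap R B a ∈ Q → ¬ FullCl p (Localization.AtPrime Q)) :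
    (∀ (Q : Ideal B') [Q.IsPrime], CMCl (Localization.AtPrime Q)) ∧
      (∀ (Q : Ideal B') [Q.IsPrime], algebraMap R B' (e a) ∈ Q → ¬ FullCl p (Localization.AtPrime Q)) := by
  refine ⟨fun Q _ => ?_, fun Q _ hQ hfull => ?_⟩
  · obtain ⟨eQ⟩ := E8Char5FiModel.nonempty_ringEquiv_localization_comap E₀ Q
    exact FiLocusOpenOfAffine.cmClause_of_ringEquiv eQ (hCM (Q.comap E₀.toRingHom))
  · obtain ⟨eQ⟩ := E8Char5FiModel.nonempty_ringEquiv_localization_comap E₀ Q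
    have ha : algebraMap R B a ∈ Q.comap E₀.toRingHom := by
      rw [Ideal.mem_comap, RingEquiv.toRingHom_eq_coe, RingEquiv.coe_toRingHom, hE₀]; exact hQ
    exact hbad (Q.comap E₀.toRingHom) ha (WFixAtNonClosedDimTwo.fullCl_of_ringEquiv p eQ.symm hfull)

/-! ## §2 The automorphisms `X₁ ↔ X_j` (`j = 2, 3`) of `A₀` -/

variable (k : Type) [Field k]

/-- For `j ∈ {2, 3}`: the transposition `X₁ ↔ X_j` fixes `f`, so induces `σ̄ : A₀ ≃+* A₀` with `σ̄ x̄ᵢ = x̄_{swap i}`; `σ̄` fixes `τ` and sends `ȳ` to `x̄_j`.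
[plumbing] -/
theorem exists_swap_auto (f : MvPolynomial (Fin 5) k) (hf : f = X 4 ^ 2 + X 0 ^ 4 * X 4 + X 1 ^ 3 + X 2 ^ 3 + X 3 ^ 3) (j : Fin 5) (hj : j = 2 ∨ j = 3) :
    ∃ σ : (MvPolynomial (Fin 5) k ⧸ Ideal.span {f}) ≃+* (MvPolynomial (Fin 5) k ⧸ Ideal.span {f}),
      (∀ i : Fin 5, σ (Ideal.Quotient.mk (Ideal.span {f}) (X i)) = Ideal.Quotient.mk (Ideal.span {f}) (X (Equiv.swap 1 j i))) ∧
      Ideal.map σ (Ideal.span {Ideal.Quotient.mk (Ideal.span {f}) (X 0) ^ 2, Ideal.Quotient.mk (Ideal.span {f}) (X 1),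
          Ideal.Quotient.mk (Ideal.span {f}) (X 2), Ideal.Quotient.mk (Ideal.span {f}) (X 3), Ideal.Quotient.mk (Ideal.span {f}) (X 4)}) =
        Ideal.span {Ideal.Quotient.mk (Ideal.span {f}) (X 0) ^ 2, Ideal.Quotient.mk (Ideal.span {f}) (X 1),
          Ideal.Quotient.mk (Ideal.span {f}) (X 2), Ideal.Quotient.mk (Ideal.span {f}) (X 3), Ideal.Quotient.mk (Ideal.span {f}) (X 4)} ∧
      σ (Ideal.Quotient.mk (Ideal.span {f}) (X 1)) = Ideal.Quotient.mk (Ideal.span {f}) (X j) := by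
  set ρ : MvPolynomial (Fin 5) k ≃+* MvPolynomial (Fin 5) k := (renameEquiv k (Equiv.swap (1 : Fin 5) j)).toRingEquiv with hρ
  have hρX : ∀ i : Fin 5, ρ (X i) = X (Equiv.swap 1 j i) := fun i => rename_X _ i
  have hρf : ρ f = f := by
    rw [hf]
    simp only [map_add, map_mul, map_pow, hρX]
    rcases hj with rfl | rfl
    · rw [show Equiv.swap (1 : Fin 5) 2 4 = 4 by decide, show Equiv.swap (1 : Fin 5) 2 0 = 0 by decide, Equiv.swap_apply_left,
        Equiv.swap_apply_right, show Equiv.swap (1 : Fin 5) 2 3 = 3 by decide]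
      ring
    · rw [show Equiv.swap (1 : Fin 5) 3 4 = 4 by decide, show Equiv.swap (1 : Fin 5) 3 0 = 0 by decide, Equiv.swap_apply_left,
        Equiv.swap_apply_right, show Equiv.swap (1 : Fin 5) 3 2 = 2 by decide]
      ring
  have hIJ : Ideal.span {f} = Ideal.map (ρ : MvPolynomial (Fin 5) k →+* MvPolynomial (Fin 5) k) (Ideal.span {f}) := by
    rw [Ideal.map_span, Set.image_singleton]
    exact congrArg _ (congrArg _ hρf.symm)
  refine ⟨Ideal.quotientEquiv (Ideal.span {f}) (Ideal.span {f}) ρ hIJ, fun i => ?_, ?_, ?_⟩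
  · rw [Ideal.quotientEquiv_mk, hρX]
  · have himg : ∀ i : Fin 5, Ideal.quotientEquiv (Ideal.span {f}) (Ideal.span {f}) ρ hIJ (Ideal.Quotient.mk (Ideal.span {f}) (X i)) =
        Ideal.Quotient.mk (Ideal.span {f}) (X (Equiv.swap 1 j i)) := fun i => by rw [Ideal.quotientEquiv_mk, hρX]
    rw [Ideal.map_span]
    simp only [Set.image_insert_eq, Set.image_singleton, map_pow, himg]
    rcases hj with rfl | rfl
    · rw [show Equiv.swap (1 : Fin 5) 2 4 = 4 by decide, show Equiv.swap (1 : Fin 5) 2 0 = 0 by decide, Equiv.swap_apply_left,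
        Equiv.swap_apply_right, show Equiv.swap (1 : Fin 5) 2 3 = 3 by decide]
      exact congrArg Ideal.span (by ext; simp only [Set.mem_insert_iff, Set.mem_singleton_iff]; tauto)
    · rw [show Equiv.swap (1 : Fin 5) 3 4 = 4 by decide, show Equiv.swap (1 : Fin 5) 3 0 = 0 by decide, Equiv.swap_apply_left,
        Equiv.swap_apply_right, show Equiv.swap (1 : Fin 5) 3 2 = 2 by decide]
      exact congrArg Ideal.span (by ext; simp only [Set.mem_insert_iff, Set.mem_singleton_iff]; tauto)
  · rw [Ideal.quotientEquiv_mk, hρX, Equiv.swap_apply_left]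

/-! ## §3 The charts `D(ū)` and `D(t̄)` -/

/-- ★/★★ **Charts `D(x̄_j)`, `j ∈ {2,3}` (= `D(ū)`, `D(t̄)`): CM at every prime of `A₀[τ/x̄_j]`, and `¬ FullCl 2` at every prime containing `x̄_j/1`**
(transport of `TauFloorOneChartYTransport` along the symmetry `X₁ ↔ X_j`). [folklore] -/
theorem chart_facts_of_swap [CharP k 2] (f : MvPolynomial (Fin 5) k) (hf : f = X 4 ^ 2 + X 0 ^ 4 * X 4 + X 1 ^ 3 + X 2 ^ 3 + X 3 ^ 3)
    (j : Fin 5) (hj : j = 2 ∨ j = 3) :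
    (∀ (Q : Ideal (blowupAlgebra (Ideal.span {Ideal.Quotient.mk (Ideal.span {f}) (X 0) ^ 2, Ideal.Quotient.mk (Ideal.span {f}) (X 1),
        Ideal.Quotient.mk (Ideal.span {f}) (X 2), Ideal.Quotient.mk (Ideal.span {f}) (X 3), Ideal.Quotient.mk (Ideal.span {f}) (X 4)} :
          Ideal (MvPolynomial (Fin 5) k ⧸ Ideal.span {f})) (Ideal.Quotient.mk (Ideal.span {f}) (X j)))) [Q.IsPrime],
        CMCl (Localization.AtPrime Q)) ∧
    (∀ (Q : Ideal (blowupAlgebra (Ideal.span {Ideal.Quotient.mk (Ideal.span {f}) (X 0) ^ 2, Ideal.Quotient.mk (Ideal.span {f}) (X 1),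
        Ideal.Quotient.mk (Ideal.span {f}) (X 2), Ideal.Quotient.mk (Ideal.span {f}) (X 3), Ideal.Quotient.mk (Ideal.span {f}) (X 4)} :
          Ideal (MvPolynomial (Fin 5) k ⧸ Ideal.span {f})) (Ideal.Quotient.mk (Ideal.span {f}) (X j)))) [Q.IsPrime],
        algebraMap (MvPolynomial (Fin 5) k ⧸ Ideal.span {f}) _ (Ideal.Quotient.mk (Ideal.span {f}) (X j)) ∈ Q → ¬ FullCl 2 (Localization.AtPrime Q)) := by
  obtain ⟨σ, -, hτ, hy⟩ := exists_swap_auto k f hf j hj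
  obtain ⟨E₀, hE₀⟩ := exists_blowupAlgebra_congr' σ _ _ hτ _ _ hy
  have h := transport σ E₀ hE₀ 2 (Ideal.Quotient.mk (Ideal.span {f}) (X 1))
    (fun Q _ => TauFloorOneChartYTransport.cmCl_localization_blowupAlgebra k f hf Q)
    (fun Q _ hQ => TauFloorOneChartYTransport.not_fullCl_localization_blowupAlgebra k f hf Q hQ)
  rw [hy] at h
  exact h

end Summit.ResolutionOfSingularities.ResolutionOfSingularities.Theorems.FInjectiveMacaulayfication.TauFloorOneChartSymmetry

end
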